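import Summits.AtomisticToContinuum.Crystallization.Theses.OneCentreSteepnessLadder

/-!
# Assembly — glue for route OneCentreSteepnessLadder at the summit value `q = 6`

Closes item stmt-AtomisticToContinuum-12889 (`Assembly`): the implication
`OneCentreDominationLJ → ZeroDensityOfDefects → ExactificationCascade → DominationEnergyLimit →
Crystallization`.  Pure bookkeeping: unpack the target `X = OneCentreDominationLJ` into the
separation constant `δ`, the hcp scale `(a, h)` with its window `2a < 3h`, `6h < 5a`, the
`δ`-separation of Lennard-Jones ground states and coercive one-centre domination at exponent `6`;
transport separation to `miePotential 6` and obtain existence of `miePotential 6` ground states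
from the PROVED Literature theorem `LennardJonesGroundStatesExist_holds` via
`miePotential_six : miePotential 6 = lennardJones`; instantiate the three `∀ q ≥ 4` support
lemmas at `q = 6` (zero density of defective centres, hull exactification, energy limit);
rewrite back to `lennardJones` and pair the two Blanc–Lewin conjuncts.
-/

namespace Summit.AtomisticToContinuum.Crystallization.Theorems

open Summit.AtomisticToContinuum.Crystallization.Theses.OneCentreSteepnessLadder

/-- **Assembly** (item stmt-AtomisticToContinuum-12889).  From coercive one-centre domination for
Lennard-Jones (`OneCentreDominationLJ`, witness `(δ, a, h)`) and the three `q`-uniform support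
lemmas `ZeroDensityOfDefects`, `ExactificationCascade`, `DominationEnergyLimit` instantiated at
`q = 6` (where `miePotential 6 = lennardJones`, `miePotential_six`, and Lennard-Jones ground
states exist for every `N`, `LennardJonesGroundStatesExist_holds`), conclude `Crystallization =
HasPeriodicGroundStateEnergy lennardJones 3 ∧ IsCrystallizing lennardJones 3`. -/
theorem oneCentreSteepnessLadder_assembly_proof :
    Summit.AtomisticToContinuum.Crystallization.Theses.OneCentreSteepnessLadder.Assembly := by
  unfold Theses.OneCentreSteepnessLadder.Assembly
  intro hX hZ hEx hE
  obtain ⟨δ, a, h, hδ, ha, hh, hw₁, hw₂, hsep, hdom⟩ := hX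
  have hsep' : ∀ (N : ℕ) (x : Fin N → EuclideanSpace ℝ (Fin 3)),
      Literature.MathematicalPhysics.StatisticalMechanics.IsGroundState
        (Literature.MathematicalPhysics.StatisticalMechanics.miePotential 6) x →
      ∀ i j : Fin N, i ≠ j → δ ≤ dist (x i) (x j) := by
    rw [Literature.MathematicalPhysics.StatisticalMechanics.miePotential_six]; exact hsep
  have hex : ∀ N : ℕ, ∃ x : Fin N → EuclideanSpace ℝ (Fin 3),
      Literature.MathematicalPhysics.StatisticalMechanics.IsGroundState
        (Literature.MathematicalPhysics.StatisticalMechanics.miePotential 6) x := by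
    rw [Literature.MathematicalPhysics.StatisticalMechanics.miePotential_six]
    exact Literature.MathematicalPhysics.StatisticalMechanics.LennardJonesGroundStatesExist_holds
  have h46 : (4 : ℕ) ≤ 6 := by norm_num
  have hzd := hZ 6 h46 δ a h hδ ha hh hsep' hdom
  have hcr := hEx 6 h46 δ a h hδ ha hh hw₁ hw₂ hsep' hzd
  have hen := hE 6 h46 δ a h hδ ha hh hex hsep' hdom
  rw [Literature.MathematicalPhysics.StatisticalMechanics.miePotential_six] at hcr hen
  exact And.intro hen hcr

end Summit.AtomisticToContinuum.Crystallization.Theorems
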